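import Mathlib
import Summits.AtomisticToContinuum.Crystallization.Theorems.GappedShellCensusFiveFoldRationingRStubFfrLineCensus

/-!
# Crux `GappedShellCensus.FiveFoldRationingR` (stmt-AtomisticToContinuum-18071), line `Sketch` —
# stub `stub_ffrLineCensusC` (counting on a quasi-line, existential quasi-geodesy constant)

Rework of the landed `stub_ffrLineCensus` with the quasi-geodesy constant made existential. If the
five-sites of a configuration are empty or form ONE bi-infinite chain `z : ℤ → ℝ³` with
`c · |i - j| ≤ dist (z i) (z j)` for some `c > 0`, then they satisfy the zero-density census: about
`p = z 0`, the five-sites in `B̄(p, r)` are `z i` with `|i| ≤ r/c`, so there are `≤ 2r/c + 1 ≤ 3r/c` of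
them for `r ≥ c`, which is `≤ ε (r/a)³` once moreover `r ≥ 1` and `r ≥ 3a³/(cε)`. The interval count
`ffrLine_card_Icc` is reused from the landed `stub_ffrLineCensus` module.
-/

noncomputable section

namespace Summit.AtomisticToContinuum.Crystallization.Theorems

/-- Index bound on a quasi-line: if `c · |i - 0| ≤ r` (`c > 0`) then `i ∈ [-⌊r/c⌋₊, ⌊r/c⌋₊]`.
[folklore] -/
theorem ffrLineC_index_mem_Icc {c r : ℝ} (hc : 0 < c) {i : ℤ}
    (h : c * |((i : ℝ) - ((0 : ℤ) : ℝ))| ≤ r) :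
    i ∈ Finset.Icc (-(⌊r / c⌋₊ : ℤ)) (⌊r / c⌋₊ : ℤ) := by
  rw [Int.cast_zero, sub_zero] at h
  have habs : |(i : ℝ)| ≤ r / c := by
    rw [le_div_iff₀ hc]
    linarith
  have hnat : ((i.natAbs : ℕ) : ℝ) ≤ r / c := by
    rw [Nat.cast_natAbs, Int.cast_abs]
    exact habs
  have hfl : i.natAbs ≤ ⌊r / c⌋₊ := Nat.le_floor hnat
  rw [Finset.mem_Icc]
  omega

/-- Arithmetic: for `0 < a`, `0 < c`, `0 < ε` and `r ≥ c`, `r ≥ 1`, `r ≥ 3a³/(cε)` we have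
`2 · (r/c) + 1 ≤ ε (r/a)³`. [folklore] -/
theorem ffrLineC_arith {a c ε r : ℝ} (ha : 0 < a) (hc : 0 < c) (hε : 0 < ε) (hcr : c ≤ r)
    (h1 : 1 ≤ r) (h3 : 3 * a ^ 3 / (c * ε) ≤ r) :
    2 * (r / c) + 1 ≤ ε * (r / a) ^ 3 := by
  have hr : 0 < r := lt_of_lt_of_le one_pos h1
  have ha3 : 0 < a ^ 3 := by positivity
  -- `1 ≤ r / c`, hence `2 (r/c) + 1 ≤ 3 (r/c)`
  have hrc : 1 ≤ r / c := by
    rw [le_div_iff₀ hc]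
    linarith
  have hstep : 2 * (r / c) + 1 ≤ 3 * (r / c) := by linarith
  -- `3 a³ ≤ c ε r ≤ c ε r²`
  have h3' : 3 * a ^ 3 ≤ c * ε * r := by
    have := h3
    rw [div_le_iff₀ (by positivity)] at this
    linarith
  have hrr : r ≤ r ^ 2 := by nlinarith
  have h3'' : 3 * a ^ 3 ≤ c * ε * r ^ 2 := by
    have hcε : 0 ≤ c * ε := by positivity
    calc 3 * a ^ 3 ≤ c * ε * r := h3'
      _ ≤ c * ε * r ^ 2 := by exact mul_le_mul_of_nonneg_left hrr hcε
  -- conclude: `3 (r/c) ≤ ε r³ / a³`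
  have hmain : 3 * (r / c) ≤ ε * (r / a) ^ 3 := by
    have e1 : 3 * (r / c) = 3 * r / c := by ring
    have e2 : ε * (r / a) ^ 3 = ε * r ^ 3 / a ^ 3 := by rw [div_pow]; ring
    rw [e1, e2, div_le_div_iff₀ hc ha3]
    -- goal: `3 * r * a ^ 3 ≤ ε * r ^ 3 * c`
    have e3 : 3 * r * a ^ 3 = r * (3 * a ^ 3) := by ring
    have e4 : ε * r ^ 3 * c = r * (c * ε * r ^ 2) := by ring
    rw [e3, e4]
    exact mul_le_mul_of_nonneg_left h3'' hr.le
  linarith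

/-- **Stub Q' (counting on a quasi-line, existential constant; provable now — rework of the landed
`stub_ffrLineCensus`, p142416).** If the five-sites are empty or the range of a chain `z : ℤ → ℝ³` with
`c·|i − j| ≤ dist (z i) (z j)` for some `c > 0`, they have lower density zero at large scales: about `z 0`
the five-sites in `B̄(z 0, r)` are `z i` with `|i| ≤ r/c`, at most `2r/c + 1 ≤ ε (r/a)³` of them for `r`
large. [folklore] -/
theorem stub_ffrLineCensusC :
    ∀ (Y : Set (EuclideanSpace ℝ (Fin 3))) (a : ℝ), 0 < a →
      ({y ∈ Y | ∃ v ∈ Y, v ≠ y ∧ dist y v ≤ a * (1 + 1 / 50) ∧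
          5 ≤ {w ∈ Y | w ≠ y ∧ w ≠ v ∧ dist y w ≤ a * (1 + 1 / 50) ∧
            dist v w ≤ a * (1 + 1 / 50)}.ncard} = ∅ ∨
        ∃ (z : ℤ → EuclideanSpace ℝ (Fin 3)) (c : ℝ), 0 < c ∧ (∀ i, z i ∈ Y) ∧
          (∀ i, dist (z i) (z (i + 1)) ≤ a * (1 + 1 / 50)) ∧
          (∀ i j : ℤ, c * |((i : ℝ) - j)| ≤ dist (z i) (z j)) ∧
          {y ∈ Y | ∃ v ∈ Y, v ≠ y ∧ dist y v ≤ a * (1 + 1 / 50) ∧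
          5 ≤ {w ∈ Y | w ≠ y ∧ w ≠ v ∧ dist y w ≤ a * (1 + 1 / 50) ∧
            dist v w ≤ a * (1 + 1 / 50)}.ncard} = Set.range z) →
      ∀ ε : ℝ, 0 < ε → ∀ r₀ : ℝ, ∃ (p : EuclideanSpace ℝ (Fin 3)) (r : ℝ), r₀ ≤ r ∧
        (({y ∈ Y | ∃ v ∈ Y, v ≠ y ∧ dist y v ≤ a * (1 + 1 / 50) ∧
          5 ≤ {w ∈ Y | w ≠ y ∧ w ≠ v ∧ dist y w ≤ a * (1 + 1 / 50) ∧
            dist v w ≤ a * (1 + 1 / 50)}.ncard} ∩ Metric.closedBall p r).ncard : ℝ) ≤ ε * (r / a) ^ 3 := by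
  intro Y a ha hF ε hε r₀
  rcases hF with hempty | ⟨z, c, hc, -, -, hq, hFz⟩
  · -- no five-sites: any centre, radius `max r₀ 0`
    refine ⟨0, max r₀ 0, le_max_left _ _, ?_⟩
    rw [hempty, Set.empty_inter, Set.ncard_empty, Nat.cast_zero]
    have : 0 ≤ max r₀ 0 / a := div_nonneg (le_max_right _ _) ha.le
    positivity
  · -- one quasi-line: centre `z 0`, radius `max r₀ (max c (max 1 (3 a³ / (c ε))))`
    set r := max r₀ (max c (max 1 (3 * a ^ 3 / (c * ε)))) with hr
    have hcr : c ≤ r := le_trans (le_max_left _ _) (le_max_right _ _)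
    have h1r : 1 ≤ r :=
      le_trans (le_trans (le_max_left _ _) (le_max_right _ _)) (le_max_right _ _)
    have h3r : 3 * a ^ 3 / (c * ε) ≤ r :=
      le_trans (le_trans (le_max_right _ _) (le_max_right _ _)) (le_max_right _ _)
    refine ⟨z 0, r, le_max_left _ _, ?_⟩
    rw [hFz]
    set N : ℕ := ⌊r / c⌋₊ with hN
    -- the five-sites in the ball are `z i` with `i ∈ [-N, N]`
    have hsub : Set.range z ∩ Metric.closedBall (z 0) r ⊆
        z '' (↑(Finset.Icc (-(N : ℤ)) (N : ℤ)) : Set ℤ) := by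
      rintro x ⟨⟨i, rfl⟩, hx⟩
      rw [Metric.mem_closedBall] at hx
      refine ⟨i, ?_, rfl⟩
      rw [Finset.mem_coe]
      exact ffrLineC_index_mem_Icc hc ((hq i 0).trans hx)
    have hfin : (z '' (↑(Finset.Icc (-(N : ℤ)) (N : ℤ)) : Set ℤ)).Finite :=
      (Finset.finite_toSet _).image z
    have hle : (Set.range z ∩ Metric.closedBall (z 0) r).ncard ≤ 2 * N + 1 :=
      calc (Set.range z ∩ Metric.closedBall (z 0) r).ncard
          ≤ (z '' (↑(Finset.Icc (-(N : ℤ)) (N : ℤ)) : Set ℤ)).ncard := Set.ncard_le_ncard hsub hfin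
        _ ≤ ((↑(Finset.Icc (-(N : ℤ)) (N : ℤ)) : Set ℤ)).ncard := Set.ncard_image_le (Finset.finite_toSet _)
        _ = 2 * N + 1 := by rw [Set.ncard_coe_finset, ffrLine_card_Icc]
    have hcast : ((Set.range z ∩ Metric.closedBall (z 0) r).ncard : ℝ) ≤ 2 * (N : ℝ) + 1 := by
      exact_mod_cast hle
    have hNle : (N : ℝ) ≤ r / c := by
      rw [hN]
      refine Nat.floor_le ?_
      have : 0 ≤ r := le_trans zero_le_one h1r
      positivity
    calc ((Set.range z ∩ Metric.closedBall (z 0) r).ncard : ℝ) ≤ 2 * (N : ℝ) + 1 := hcast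
      _ ≤ 2 * (r / c) + 1 := by linarith
      _ ≤ ε * (r / a) ^ 3 := ffrLineC_arith ha hc hε hcr h1r h3r

end Summit.AtomisticToContinuum.Crystallization.Theorems

end
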